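import Mathlib
import Literature.NumberTheory.GaloisRepresentations.AbsGaloisOuterConj
import Literature.NumberTheory.Automorphic.LanglandsTetrahedral

/-!
# Support for `TwistNormalization` (route `QuadraticWindow`, stmt-Langlands-10904), I:
# characters and complex conjugations along `Γ_F ↪ Γ_{F₀}` for a quadratic `F/F₀`

Pure group theory / Galois bookkeeping used by the twist-normalisation argument (the parity of the
polarization character is changed by twisting `π` with a Hecke character of `F`; on the Galois side
the new Artin avatar on `Γ_{F₀}` is obtained by EXTENDING a `τ`-invariant character of the index-two
subgroup `Γ_F`):

* `exists_monoidHom_extend_of_index_two` — a character `ξ : H → C` (`C` commutative with square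
  roots) of a subgroup `r : H ↪ G` of index two, invariant under conjugation by an element
  `t ∉ r(H)`, extends to a character of `G` (the obstruction lives in `H²(ℤ/2, C) = C/C² = 1`);
* `isOpen_ker_of_comp_absGaloisRestrict` — for `F/F₀` quadratic, a character of `Γ_{F₀}` whose
  restriction to `Γ_F` has open kernel has open kernel (`Γ_F` is open in `Γ_{F₀}`);
* `isComplexConjugation_absGaloisOuterConj` — the outer action `θ_t` of `t ∈ Γ_{F₀}` on `Γ_F`
  (`absGaloisOuterConj`) carries a complex conjugation at the real place `φ` of `F` to a complex
  conjugation at the real place `φ ∘ τ̄⁻¹`, `τ̄ = absGaloisQuot F₀ F t ∈ Gal(F/F₀)`.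

References: J.-P. Serre, *Linear representations of finite groups* (1977), §7.2–8.1 (characters of
a normal subgroup of index two); J. Neukirch, *Algebraic Number Theory* (1999), Ch. IV §1;
J. S. Milne, *Fields and Galois Theory*, §7.
-/

set_option linter.dupNamespace false -- project-wide option (lakefile weak.linter.dupNamespace); `Summit.Langlands.Langlands` is the mandated namespace

open Literature.NumberTheory.GaloisRepresentations Literature.NumberTheory.Automorphic
open Field

namespace Summit.Langlands.Langlands.Theorems.TwistNormalization

/-! ## Extension of invariant characters from a subgroup of index two -/

/-- **Extension of a `t`-invariant character from a subgroup of index two.**  Let `r : H → G` be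
an injective homomorphism whose image has index `2`, `t ∉ r(H)`, `θ' : H → H` the conjugation by
`t⁻¹` pulled back to `H` (`r (θ' h) = t⁻¹ r(h) t`), and `ξ : H → C` a homomorphism to a commutative
group in which every element is a square, with `ξ ∘ θ' = ξ`.  Then `ξ = δ ∘ r` for a homomorphism
`δ : G → C` (put `δ(t) = d` with `d² = ξ(r⁻¹(t²))` and `δ(t r(k)) = d ξ(k)`).  Serre, *Linear
representations of finite groups*, §8.1. [folklore] -/
theorem exists_monoidHom_extend_of_index_two {G H C : Type*} [Group G] [Group H] [CommGroup C]
    (hC : ∀ x : C, ∃ y : C, y * y = x)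
    (r : H →* G) (hr : Function.Injective r) (h2 : r.range.index = 2) {t : G} (ht : t ∉ r.range)
    (θ' : H → H) (hθ' : ∀ h, r (θ' h) = t⁻¹ * r h * t)
    (ξ : H →* C) (hinv : ∀ h, ξ (θ' h) = ξ h) :
    ∃ δ : G →* C, ∀ h, δ (r h) = ξ h := by
  classical
  -- `t * t ∈ r(H)`
  have htt : t * t ∈ r.range := (Subgroup.mul_mem_iff_of_index_two h2).2 Iff.rfl
  obtain ⟨h₀, hh₀⟩ := htt
  obtain ⟨d, hd⟩ := hC (ξ h₀)
  -- every element is `r h` or `t * r k`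
  have hdec : ∀ g : G, (∃ h, g = r h) ∨ ∃ k, g = t * r k := by
    intro g
    by_cases hg : g ∈ r.range
    · obtain ⟨h, rfl⟩ := hg
      exact Or.inl ⟨h, rfl⟩
    · have htg : t⁻¹ * g ∈ r.range := by
        rw [Subgroup.mul_mem_iff_of_index_two h2, inv_mem_iff]
        exact ⟨fun h => absurd h ht, fun h => absurd h hg⟩
      obtain ⟨k, hk⟩ := htg
      exact Or.inr ⟨k, by rw [hk, mul_inv_cancel_left]⟩
  have hnot : ∀ k, t * r k ∉ r.range := fun k hk => by
    rw [Subgroup.mul_mem_iff_of_index_two h2] at hk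
    exact ht (hk.2 ⟨k, rfl⟩)
  have hmem' : ∀ g, g ∉ r.range → t⁻¹ * g ∈ r.range := fun g hg => by
    rw [Subgroup.mul_mem_iff_of_index_two h2, inv_mem_iff]
    exact ⟨fun h => absurd h ht, fun h => absurd h hg⟩
  -- the candidate function
  set f : G → C := fun g =>
    if hg : g ∈ r.range then ξ (Classical.choose hg) else d * ξ (Classical.choose (hmem' g hg)) with hf
  have hf1 : ∀ h, f (r h) = ξ h := by
    intro h
    have hmem : r h ∈ r.range := ⟨h, rfl⟩
    simp only [hf, dif_pos hmem]
    congr 1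
    exact hr (Classical.choose_spec hmem)
  have hf2 : ∀ k, f (t * r k) = d * ξ k := by
    intro k
    simp only [hf, dif_neg (hnot k)]
    congr 2
    apply hr
    rw [Classical.choose_spec (hmem' _ (hnot k)), inv_mul_cancel_left]
  -- conjugation identities
  have hc1 : ∀ h, t⁻¹ * r h * t = r (θ' h) := fun h => (hθ' h).symm
  have hprod_hk : ∀ h k, r h * (t * r k) = t * r (θ' h * k) := fun h k => by
    rw [map_mul, hθ' h]; group
  have hprod_kk : ∀ k₁ k₂, t * r k₁ * (t * r k₂) = r (h₀ * (θ' k₁ * k₂)) := fun k₁ k₂ => by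
    rw [map_mul, map_mul, hθ', hh₀]; group
  refine ⟨{ toFun := f, map_one' := ?_, map_mul' := ?_ }, hf1⟩
  · have := hf1 1
    rwa [map_one, map_one] at this
  · intro a b
    rcases hdec a with ⟨h₁, rfl⟩ | ⟨k₁, rfl⟩ <;> rcases hdec b with ⟨h₂, rfl⟩ | ⟨k₂, rfl⟩
    · rw [← map_mul, hf1, hf1, hf1, map_mul]
    · rw [hprod_hk, hf2, hf1, hf2, map_mul, hinv]
      simp only [mul_left_comm]
    · rw [mul_assoc, ← map_mul, hf2, hf2, hf1, map_mul, mul_assoc]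
    · rw [hprod_kk, hf1, hf2, hf2, map_mul, map_mul, hinv, ← hd]
      simp only [mul_comm, mul_left_comm, mul_assoc]

/-- Every unit of `ℂ` is a square. [folklore] -/
theorem Complex.units_exists_mul_self (x : ℂˣ) : ∃ y : ℂˣ, y * y = x := by
  obtain ⟨z, hz⟩ := IsAlgClosed.exists_pow_nat_eq (x : ℂ) two_pos
  have hz0 : z ≠ 0 := by
    rintro rfl
    rw [zero_pow two_ne_zero] at hz
    exact x.ne_zero hz.symm
  refine ⟨Units.mk0 z hz0, Units.ext ?_⟩
  rw [Units.val_mul, Units.val_mk0, ← pow_two, hz]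

/-! ## The quadratic window: `Γ_F ↪ Γ_{F₀}` of index two -/

section Quadratic

variable {F₀ F : Type} [Field F₀] [NumberField F₀] [Field F] [NumberField F] [Algebra F₀ F]

/-- For `[F : F₀] = 2`, `F/F₀` is Galois (a quadratic extension in characteristic zero). [folklore] -/
theorem isGalois_of_finrank_eq_two (hdeg : Module.finrank F₀ F = 2) : IsGalois F₀ F := by
  haveI : FiniteDimensional F₀ F := Module.finite_of_finrank_eq_succ hdeg
  haveI : Algebra.IsQuadraticExtension F₀ F := ⟨hdeg⟩
  infer_instance

/-- For `[F : F₀] = 2`: `res(Γ_F) ≤ Γ_{F₀}` is open of index `2`. [folklore] -/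
theorem isOpen_range_and_index_eq_two (hdeg : Module.finrank F₀ F = 2) :
    IsOpen (((absGaloisRestrict F₀ F).range : Subgroup (absoluteGaloisGroup F₀)) :
      Set (absoluteGaloisGroup F₀)) ∧
      ((absGaloisRestrict F₀ F).range : Subgroup (absoluteGaloisGroup F₀)).index = 2 := by
  haveI : FiniteDimensional F₀ F := Module.finite_of_finrank_eq_succ hdeg
  obtain ⟨hopen, hindex⟩ := isOpen_range_absGaloisRestrict_and_index F₀ F
  exact ⟨hopen, hindex.trans hdeg⟩

/-- `res : Γ_F → Γ_{F₀}` is an open embedding when `[F : F₀] = 2`. [folklore] -/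
theorem isOpenEmbedding_absGaloisRestrict (hdeg : Module.finrank F₀ F = 2) :
    Topology.IsOpenEmbedding (absGaloisRestrict F₀ F) := by
  haveI : FiniteDimensional F₀ F := Module.finite_of_finrank_eq_succ hdeg
  refine ⟨(isClosedEmbedding_absGaloisRestrict F₀ F).isEmbedding, ?_⟩
  have h := (isOpen_range_and_index_eq_two hdeg).1
  rwa [MonoidHom.coe_range] at h

/-- A lift `t ∈ Γ_{F₀}` of the non-trivial automorphism `τ` of the quadratic `F/F₀` does not lie
in `res(Γ_F)`. [folklore] -/
theorem not_mem_range_of_absGaloisQuot_eq (hdeg : Module.finrank F₀ F = 2) {τ : F ≃ₐ[F₀] F}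
    (hτ : τ ≠ 1) {t : absoluteGaloisGroup F₀}
    (ht : haveI := isGalois_of_finrank_eq_two hdeg; absGaloisQuot F₀ F t = τ) :
    t ∉ ((absGaloisRestrict F₀ F).range : Subgroup (absoluteGaloisGroup F₀)) := by
  haveI := isGalois_of_finrank_eq_two hdeg
  intro hmem
  rw [← absGaloisQuot_eq_one_iff] at hmem
  exact hτ (ht.symm.trans hmem)

/-- **Extension of `θ_t`-invariant characters of `Γ_F` to `Γ_{F₀}`** (`[F : F₀] = 2`, `t ∈ Γ_{F₀}`
lifting the non-trivial automorphism `τ`): a character `ξ : Γ_F → ℂˣ` with `ξ ∘ θ_{t⁻¹} = ξ`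
(`θ_{t⁻¹} = absGaloisOuterConj F₀ F t⁻¹`) is the restriction `δ ∘ res` of a character
`δ : Γ_{F₀} → ℂˣ`. Serre, *Linear representations of finite groups*, §8.1. [folklore] -/
theorem exists_character_extend (hdeg : Module.finrank F₀ F = 2) {τ : F ≃ₐ[F₀] F} (hτ : τ ≠ 1)
    {t : absoluteGaloisGroup F₀}
    (ht : haveI := isGalois_of_finrank_eq_two hdeg; absGaloisQuot F₀ F t = τ)
    (ξ : absoluteGaloisGroup F →* ℂˣ)
    (hinv : haveI := isGalois_of_finrank_eq_two hdeg;
      ∀ σ, ξ (absGaloisOuterConj F₀ F t⁻¹ σ) = ξ σ) :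
    ∃ δ : absoluteGaloisGroup F₀ →* ℂˣ, ∀ σ, δ (absGaloisRestrict F₀ F σ) = ξ σ := by
  haveI := isGalois_of_finrank_eq_two hdeg
  haveI : FiniteDimensional F₀ F := Module.finite_of_finrank_eq_succ hdeg
  refine exists_monoidHom_extend_of_index_two Complex.units_exists_mul_self
    (absGaloisRestrict F₀ F).toMonoidHom (absGaloisRestrict_injective F₀ F)
    (isOpen_range_and_index_eq_two hdeg).2 (not_mem_range_of_absGaloisQuot_eq hdeg hτ ht)
    (absGaloisOuterConj F₀ F t⁻¹) (fun h => ?_) ξ hinv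
  change absGaloisRestrict F₀ F (absGaloisOuterConj F₀ F t⁻¹ h) = _
  rw [absGaloisRestrict_absGaloisOuterConj, inv_inv]
  rfl

/-- **Open kernels pass from `Γ_F` to `Γ_{F₀}`**: if `δ : Γ_{F₀} → C` restricts along `res` to a
homomorphism with open kernel, then `ker δ` is open (`res` is an open embedding for `[F:F₀] = 2`,
so `res(ker (δ ∘ res)) ≤ ker δ` is an open subgroup). [folklore] -/
theorem isOpen_ker_of_comp_absGaloisRestrict (hdeg : Module.finrank F₀ F = 2) {C : Type*} [Group C]
    (δ : absoluteGaloisGroup F₀ →* C)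
    (hopen : IsOpen ((δ.comp (absGaloisRestrict F₀ F).toMonoidHom).ker : Set (absoluteGaloisGroup F))) :
    IsOpen (δ.ker : Set (absoluteGaloisGroup F₀)) := by
  apply Subgroup.isOpen_mono (H₁ := ((δ.comp (absGaloisRestrict F₀ F).toMonoidHom).ker).map
    (absGaloisRestrict F₀ F).toMonoidHom)
  · rintro _ ⟨σ, hσ, rfl⟩
    exact hσ
  · rw [Subgroup.coe_map]
    exact (isOpenEmbedding_absGaloisRestrict hdeg).isOpenMap _ hopen

/-! ## Complex conjugations under the outer action -/

/-- `absEmbedding F₀ F z = (absClosureEquiv F₀ F)⁻¹ (z : F̄)` (definitional). [folklore] -/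
theorem absEmbedding_eq_symm (z : F) :
    absEmbedding F₀ F z = (absClosureEquiv F₀ F).symm (algebraMap F (AlgebraicClosure F) z) := rfl

/-- **`θ_t` carries complex conjugations at `φ` to complex conjugations at `φ ∘ τ̄⁻¹`** (`F/F₀`
Galois, `t ∈ Γ_{F₀}`, `τ̄ = absGaloisQuot F₀ F t`): if `c ∈ Γ_F` is a complex conjugation for the
real embedding `φ : F → ℝ`, then `θ_t(c) = res⁻¹(t res(c) t⁻¹)` is a complex conjugation for
`φ ∘ τ̄⁻¹`.  (With `j : F̄ → ℂ` exhibiting `c`, the embedding `j ∘ ι ∘ t⁻¹ ∘ ι⁻¹` exhibits `θ_t(c)`,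
`ι : F̄₀ ≅ F̄` the chosen identification.)  Milne, *Fields and Galois Theory*, §7. [folklore] -/
theorem isComplexConjugation_absGaloisOuterConj [IsGalois F₀ F] (t : absoluteGaloisGroup F₀)
    {φ : F →+* ℝ} {c : absoluteGaloisGroup F} (hc : IsComplexConjugation φ c) :
    IsComplexConjugation (φ.comp ((absGaloisQuot F₀ F t⁻¹ : F ≃ₐ[F₀] F) : F →+* F))
      (absGaloisOuterConj F₀ F t c) := by
  rw [isComplexConjugation_iff] at hc ⊢
  obtain ⟨j, hj1, hj2⟩ := hc
  set ιe := absClosureEquiv F₀ F with hιe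
  -- the ring automorphism `T⁻¹ = ι ∘ t⁻¹ ∘ ι⁻¹` of `F̄`
  let Tinv : AlgebraicClosure F ≃+* AlgebraicClosure F :=
    ιe.symm.toRingEquiv.trans
      (((absoluteGaloisGroup.toAlgEquiv F₀ t⁻¹).toRingEquiv).trans ιe.toRingEquiv)
  have hTinv : ∀ y, Tinv y = ιe (t⁻¹ • ιe.symm y) := fun _ => rfl
  refine ⟨j.comp Tinv.toRingHom, ?_, fun y => ?_⟩
  · ext z
    change j (Tinv (algebraMap F (AlgebraicClosure F) z)) = Complex.ofRealHom (φ (absGaloisQuot F₀ F t⁻¹ z))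
    rw [hTinv, ← absEmbedding_eq_symm, ← absEmbedding_absGaloisQuot_apply, hιe, absClosureEquiv_apply,
      absClosureEmbedding_absEmbedding]
    exact congrArg (fun f : F →+* ℂ => f (absGaloisQuot F₀ F t⁻¹ z)) hj1
  · change j (Tinv (_ • y)) = starRingEnd ℂ (j (Tinv y))
    rw [hTinv, hTinv, ← hj2]
    congr 1
    -- `t⁻¹ • ι⁻¹ (θ_t c • y) = res(c) • t⁻¹ • ι⁻¹ y`, read in `F̄₀` through `ι`
    obtain ⟨x, rfl⟩ : ∃ x, ιe x = y := ιe.surjective y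
    rw [hιe, AlgEquiv.symm_apply_apply, absClosureEquiv_apply, absClosureEquiv_apply,
      ← absGaloisRestrict_apply_smul, absGaloisRestrict_absGaloisOuterConj,
      absClosureEquiv_symm_absClosureEmbedding, smul_smul,
      show t⁻¹ * (t * absGaloisRestrict F₀ F c * t⁻¹) = absGaloisRestrict F₀ F c * t⁻¹ by group,
      mul_smul, absGaloisRestrict_apply_smul]
    rfl

end Quadratic

end Summit.Langlands.Langlands.Theorems.TwistNormalization
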